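import Literature.Probability.LatticeModels.ImprovedTreeDiagramBoundSum
import Literature.Probability.LatticeModels.SlidingScaleInfraredBoundProofs
import HarnessLib

/-!
# High-dimensional triviality of Ising scaling limits, II: the `d = 4` bound on `∑ |U₄|` — proofs

Topic `Literature/Probability/LatticeModels`; family `crit-ising` (crit-ising.S13). Sibling proof file
of `HighDimTrivialityMoments.lean` for its named fact `aizenmanDuminilCopin_ursellFourSum_le`
(M. Aizenman, H. Duminil-Copin, *Marginal triviality of the scaling limits of critical 4D Ising and
`φ⁴₄` models*, Ann. of Math. **194** (2021) 163–235 = arXiv:1912.07973, Thm 1.3 (p. 6) with the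
bound "`S(L,r,β) ≤ C₂ r¹² (log log L / log L)^c`" of §6.3 (p. 26): in the critical window of the
four-dimensional nearest-neighbour Ising model, `Σ_L⁻² ∑_{x ∈ Λ_{rL}⁴} |U₄(x)| ≤ C r¹² (log L)^{-c}`).
Theorems only: no definition, no statement, no named fact is introduced or changed.

The §6.3 summation (pp. 26–27, the bounds on the sums (1)–(4)) is the tree's theorem
`aizenmanDuminilCopin_ursellFourSum_le_of_facts` (`ImprovedTreeDiagramBoundSum.lean`), which derives
the fact from the paper's two numbered inputs: **Theorem 1.3** (the improved tree diagram bound,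
named fact `aizenmanDuminilCopin_improvedTreeDiagramBound`) and **Theorem 5.6** (the sliding-scale
infrared bound, `aizenmanDuminilCopin_slidingScaleInfraredBound`) — Lemma 6.3 (growth of the bubble
diagram), the infrared bound and the Messager–Miracle-Solé inequality being theorems there.
Theorem 5.6 is now a theorem of the tree (`aizenmanDuminilCopin_slidingScaleInfraredBound_holds`,
`SlidingScaleInfraredBoundProofs.lean`), so the fact rests on Theorem 1.3 **alone**:

* `aizenmanDuminilCopin_ursellFourSum_le_of_improvedTreeDiagramBound (h13) :
    aizenmanDuminilCopin_ursellFourSum_le`.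

The discharge `aizenmanDuminilCopin_ursellFourSum_le_holds` is this theorem applied to
`aizenmanDuminilCopin_improvedTreeDiagramBound_holds` once Theorem 1.3 (proof: ADC §4 and §6.1–6.2,
random-current multi-scale analysis; the reduction of Thm 1.3 to the intersection-clustering bound
Prop. 6.1 is the tree's `ClusteringToTreeBound.lean`) is proved; it is to be appended here.

## References

* M. Aizenman, H. Duminil-Copin, Ann. of Math. 194 (2021) 163–235, arXiv:1912.07973: Thm 1.3 (p. 6),
  Thm 5.6 (p. 18), Lemma 6.3 (p. 21), §6.3 (pp. 26–27) [AizenmanDuminilCopinAnnals2021].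
-/

namespace Literature.Probability.LatticeModels

/-- **The `d = 4` bound on `∑ |U₄|` in the critical window from Aizenman–Duminil-Copin 2021,
Theorem 1.3 alone.** The named fact `aizenmanDuminilCopin_ursellFourSum_le` (ADC 2021, §6.3, p. 26:
`Σ_L⁻² ∑_{Λ_{rL}⁴} |U₄| ≤ C r¹² (log L)^{-c}` for `β ≤ β_c(4)`, `1 < L ≤ ξ(β)` or `β = β_c`, `r ≥ 1`,
every `μ ∈ 𝒢(β,0)`) follows from the improved tree diagram bound
`aizenmanDuminilCopin_improvedTreeDiagramBound` (ADC Thm 1.3): the §6.3 summation is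
`aizenmanDuminilCopin_ursellFourSum_le_of_facts`, and its second input, the sliding-scale infrared
bound (ADC Thm 5.6), is the tree's theorem `aizenmanDuminilCopin_slidingScaleInfraredBound_holds`.
[cite: AizenmanDuminilCopinAnnals2021, arXiv:1912.07973 Thm 1.3 (p. 6), Thm 5.6 (p. 18) and §6.3, bound on S(L,r,β) (pp. 26–27)] -/
theorem aizenmanDuminilCopin_ursellFourSum_le_of_improvedTreeDiagramBound
    (h13 : aizenmanDuminilCopin_improvedTreeDiagramBound) :
    aizenmanDuminilCopin_ursellFourSum_le :=
  aizenmanDuminilCopin_ursellFourSum_le_of_facts h13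
    aizenmanDuminilCopin_slidingScaleInfraredBound_holds

end Literature.Probability.LatticeModels
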